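import Mathlib

/-!
# PneNP / ConvexRankGates — `ConvexGateBlind`: alternating sums for the rainbow pseudo-distribution

Helpers (`--supports stmt-PneNP-10680`). Elementary identities and estimates used by the RAINBOW PSEUDO-DISTRIBUTION
of a balanced colouring (files `…RainbowFunctional.lean`, `…JuntaBlind.lean`): the explicit degree-`t` Sherali–Adams
pseudo-expectation for "a `k`-set meeting every colour class of a `(k-1)`-colouring at most once", which shows that the
colouring columns of the canonical matrix `D - εJ` of the crux admit NO non-negative factorisation with `t`-junta row
factors, for every `ε > 0` and whatever the number of terms (local / symmetric LPs are exactly blind to Razborov's pair).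

* §1 Three alternating binomial identities:
  `∑ (-1)^i C(N,i) C(i,r) = 0` (`r < N`), `∑ (-1)^i C(N,i)/(i+1) = 1/(N+1)`, `∑ (-1)^i C(N,i)/((i+1)(i+2)) = 1/(N+2)`.
* §2 Supersets of a fixed set of prescribed size inside a finite set: `C(#U - #B, c - #B)` of them.
* §3 RAINBOW ALTERNATING SUMS `R_A(x) = ∑_{L ⊆ A rainbow} (-1)^{#L} n^{-#L} / (x - #L)` (a set is rainbow when the
  colouring is injective on it, `Set.InjOn`): the recursion `R_{A+v}(x) = R_A(x) - R_{A ∖ cl(v)}(x-1)/n` and the two-sided bound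
  `1/x - #A/(n(x-1)) ≤ R_A(x) ≤ 1/x` for `#A + 2 ≤ x`, `2#A ≤ n` (so `R_A(x) ≥ 0`): these are the local laws of the
  pseudo-distribution up to a positive factor.
[folklore identities; §3 is new packaging]
-/

namespace Summit.PneNP.PneNP.Theorems

open Finset

noncomputable section

/-! ## §1 Alternating binomial identities -/

/-- `∑_{i ≤ n} (-1)^i C(n,i) = [n = 0]`, real version. [folklore] -/
theorem rb_alt_sum_choose (n : ℕ) :
    ∑ i ∈ range (n + 1), (-1 : ℝ) ^ i * (n.choose i : ℝ) = if n = 0 then 1 else 0 := by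
  have h := Int.alternating_sum_range_choose (n := n)
  have h' := congrArg (Int.cast : ℤ → ℝ) h
  push_cast at h'
  rw [h']

/-- `∑_{i ≤ N} (-1)^i C(N,i) C(i,r) = 0` for `r < N`. [folklore] -/
theorem rb_alt_sum_choose_mul_choose {N r : ℕ} (hrN : r < N) :
    ∑ i ∈ range (N + 1), (-1 : ℝ) ^ i * (N.choose i : ℝ) * (i.choose r : ℝ) = 0 := by
  -- split the range at `r`: the terms `i < r` vanish
  have hsplit := Finset.sum_range_add_sum_Ico
    (fun i => (-1 : ℝ) ^ i * (N.choose i : ℝ) * (i.choose r : ℝ)) (m := r) (n := N + 1) (by omega)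
  rw [← hsplit]
  have h1 : ∑ i ∈ range r, (-1 : ℝ) ^ i * (N.choose i : ℝ) * (i.choose r : ℝ) = 0 := by
    refine Finset.sum_eq_zero fun i hi => ?_
    rw [Nat.choose_eq_zero_of_lt (mem_range.1 hi)]
    simp
  rw [h1, zero_add, Finset.sum_Ico_eq_sum_range]
  have h2 : ∀ j ∈ range (N + 1 - r),
      (-1 : ℝ) ^ (r + j) * (N.choose (r + j) : ℝ) * ((r + j).choose r : ℝ) =
        (-1 : ℝ) ^ r * (N.choose r : ℝ) * ((-1 : ℝ) ^ j * ((N - r).choose j : ℝ)) := by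
    intro j _
    have hm := Nat.choose_mul (n := N) (k := r + j) (s := r) (by omega)
    rw [Nat.add_sub_cancel_left] at hm
    have hm' : (N.choose (r + j) : ℝ) * ((r + j).choose r : ℝ) = (N.choose r : ℝ) * ((N - r).choose j : ℝ) := by
      exact_mod_cast hm
    rw [pow_add, mul_assoc, hm']
    ring
  rw [Finset.sum_congr rfl h2, ← Finset.mul_sum]
  have h3 : N + 1 - r = (N - r) + 1 := by omega
  rw [h3, rb_alt_sum_choose (N - r), if_neg (by omega)]
  simp

/-- `∑_{i ≤ N} (-1)^i C(N+1, i+1) = 1`. [folklore] -/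
theorem rb_alt_sum_choose_succ_succ (N : ℕ) :
    ∑ i ∈ range (N + 1), (-1 : ℝ) ^ i * ((N + 1).choose (i + 1) : ℝ) = 1 := by
  have h := rb_alt_sum_choose (N + 1)
  rw [if_neg (by omega), Finset.sum_range_succ'] at h
  simp only [pow_zero, Nat.choose_zero_right, Nat.cast_one, mul_one] at h
  have h2 : ∑ i ∈ range (N + 1), (-1 : ℝ) ^ (i + 1) * ((N + 1).choose (i + 1) : ℝ) =
      -∑ i ∈ range (N + 1), (-1 : ℝ) ^ i * ((N + 1).choose (i + 1) : ℝ) := by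
    rw [← Finset.sum_neg_distrib]
    refine Finset.sum_congr rfl fun i _ => ?_
    rw [pow_succ]
    ring
  rw [h2] at h
  linarith

/-- `∑_{i ≤ N} (-1)^i C(N+2, i+2) = N + 1`. [folklore] -/
theorem rb_alt_sum_choose_add_two (N : ℕ) :
    ∑ i ∈ range (N + 1), (-1 : ℝ) ^ i * ((N + 2).choose (i + 2) : ℝ) = N + 1 := by
  have h := rb_alt_sum_choose (N + 2)
  rw [if_neg (by omega), Finset.sum_range_succ', Finset.sum_range_succ'] at h
  simp only [pow_zero, Nat.choose_zero_right, Nat.cast_one, mul_one, zero_add, pow_one,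
    Nat.choose_one_right] at h
  have h2 : ∑ i ∈ range (N + 1), (-1 : ℝ) ^ (i + 1 + 1) * ((N + 2).choose (i + 1 + 1) : ℝ) =
      ∑ i ∈ range (N + 1), (-1 : ℝ) ^ i * ((N + 2).choose (i + 2) : ℝ) := by
    refine Finset.sum_congr rfl fun i _ => ?_
    rw [pow_succ, pow_succ]
    ring_nf
  rw [h2] at h
  push_cast at h
  linarith

/-- `∑_{i ≤ N} (-1)^i C(N,i)/(i+1) = 1/(N+1)`. [folklore] -/
theorem rb_alt_sum_choose_div_succ (N : ℕ) :
    ∑ i ∈ range (N + 1), (-1 : ℝ) ^ i * (N.choose i : ℝ) / (i + 1) = 1 / (N + 1) := by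
  have hN : (N : ℝ) + 1 ≠ 0 := by positivity
  have hterm : ∀ i ∈ range (N + 1), (-1 : ℝ) ^ i * (N.choose i : ℝ) / (i + 1) =
      (1 / ((N : ℝ) + 1)) * ((-1 : ℝ) ^ i * ((N + 1).choose (i + 1) : ℝ)) := by
    intro i _
    have h := Nat.add_one_mul_choose_eq N i
    have h' : ((N : ℝ) + 1) * (N.choose i : ℝ) = ((N + 1).choose (i + 1) : ℝ) * ((i : ℝ) + 1) := by
      exact_mod_cast h
    have hi : (i : ℝ) + 1 ≠ 0 := by positivity
    field_simp
    linear_combination h'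
  rw [Finset.sum_congr rfl hterm, ← Finset.mul_sum, rb_alt_sum_choose_succ_succ, mul_one]

/-- `∑_{i ≤ N} (-1)^i C(N,i)/((i+1)(i+2)) = 1/(N+2)`. [folklore] -/
theorem rb_alt_sum_choose_div_succ_succ (N : ℕ) :
    ∑ i ∈ range (N + 1), (-1 : ℝ) ^ i * (N.choose i : ℝ) / ((i + 1) * (i + 2)) = 1 / (N + 2) := by
  have hN1 : (N : ℝ) + 1 ≠ 0 := by positivity
  have hN2 : (N : ℝ) + 2 ≠ 0 := by positivity
  have hterm : ∀ i ∈ range (N + 1), (-1 : ℝ) ^ i * (N.choose i : ℝ) / ((i + 1) * (i + 2)) =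
      (1 / (((N : ℝ) + 1) * ((N : ℝ) + 2))) * ((-1 : ℝ) ^ i * ((N + 2).choose (i + 2) : ℝ)) := by
    intro i _
    have h1 := Nat.add_one_mul_choose_eq N i
    have h2 := Nat.add_one_mul_choose_eq (N + 1) (i + 1)
    have h1' : ((N : ℝ) + 1) * (N.choose i : ℝ) = ((N + 1).choose (i + 1) : ℝ) * ((i : ℝ) + 1) := by
      exact_mod_cast h1
    have h2' : ((N : ℝ) + 1 + 1) * ((N + 1).choose (i + 1) : ℝ) =
        ((N + 1 + 1).choose (i + 1 + 1) : ℝ) * ((i : ℝ) + 1 + 1) := by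
      exact_mod_cast h2
    have hi1 : (i : ℝ) + 1 ≠ 0 := by positivity
    have hi2 : (i : ℝ) + 2 ≠ 0 := by positivity
    have h22 : (N + 1 + 1).choose (i + 1 + 1) = (N + 2).choose (i + 2) := rfl
    rw [h22] at h2'
    have hprod : ((i : ℝ) + 1) * ((i : ℝ) + 2) ≠ 0 := mul_ne_zero hi1 hi2
    have hNprod : ((N : ℝ) + 1) * ((N : ℝ) + 2) ≠ 0 := mul_ne_zero hN1 hN2
    have key : (N.choose i : ℝ) / (((i : ℝ) + 1) * ((i : ℝ) + 2)) =
        ((N + 2).choose (i + 2) : ℝ) / (((N : ℝ) + 1) * ((N : ℝ) + 2)) := by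
      rw [div_eq_div_iff hprod hNprod]
      linear_combination ((N : ℝ) + 2) * h1' + ((i : ℝ) + 1) * h2'
    rw [mul_div_assoc, key]
    ring
  rw [Finset.sum_congr rfl hterm, ← Finset.mul_sum, rb_alt_sum_choose_add_two]
  field_simp

/-! ## §2 Supersets of prescribed size -/

/-- The `c`-subsets of `U` containing `B ⊆ U` are in bijection with the `(c - #B)`-subsets of `U ∖ B`; hence there are
`C(#U - #B, c - #B)` of them (`#B ≤ c`). [folklore] -/
theorem rb_card_filter_powersetCard_superset {α : Type*} [DecidableEq α] {B U : Finset α} (hBU : B ⊆ U) {c : ℕ}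
    (hc : B.card ≤ c) :
    ((U.powersetCard c).filter (fun X => B ⊆ X)).card = (U.card - B.card).choose (c - B.card) := by
  rw [← card_sdiff_of_subset hBU, ← card_powersetCard (c - B.card) (U \ B)]
  refine card_bij (fun X _ => X \ B) (fun X hX => ?_) (fun X₁ hX₁ X₂ hX₂ h => ?_) (fun Y hY => ?_)
  · rw [mem_filter, mem_powersetCard] at hX
    rw [mem_powersetCard]
    refine ⟨sdiff_subset_sdiff hX.1.1 (subset_refl _), ?_⟩
    rw [card_sdiff_of_subset hX.2, hX.1.2]
  · rw [mem_filter] at hX₁ hX₂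
    rw [← union_sdiff_of_subset hX₁.2, ← union_sdiff_of_subset hX₂.2, h]
  · rw [mem_powersetCard] at hY
    refine ⟨Y ∪ B, ?_, ?_⟩
    · rw [mem_filter, mem_powersetCard]
      have hdisj : Disjoint Y B := by
        rw [Finset.disjoint_left]
        intro a haY haB
        exact (mem_sdiff.1 (hY.1 haY)).2 haB
      refine ⟨⟨?_, ?_⟩, subset_union_right⟩
      · exact union_subset (fun a ha => (mem_sdiff.1 (hY.1 ha)).1) hBU
      · rw [card_union_of_disjoint hdisj, hY.2]
        omega
    · rw [union_sdiff_right]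
      exact sdiff_eq_self_of_disjoint (Finset.disjoint_left.2 fun a haY haB => (mem_sdiff.1 (hY.1 haY)).2 haB)

/-! ## §3 Rainbow alternating sums -/

section rainbow

variable {α κ : Type*} [DecidableEq α] [DecidableEq κ]

omit [DecidableEq κ] in
/-- For `v ∉ L`: `h` is injective on `insert v L` iff it is injective on `L` and `L` avoids the colour of `v`
("rainbow" bookkeeping). [folklore] -/
theorem rb_injOn_insert {h : α → κ} {L : Finset α} {v : α} (hv : v ∉ L) :
    Set.InjOn h (↑(insert v L) : Set α) ↔ Set.InjOn h (↑L : Set α) ∧ ∀ a ∈ L, h a ≠ h v := by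
  rw [Finset.coe_insert, Set.injOn_insert (by simpa using hv)]
  simp [Set.mem_image]

open Classical in
/-- The RAINBOW ALTERNATING SUM `R_A(x) = ∑_{L ⊆ A, L rainbow} (-1)^{#L} n^{-#L} / (x - #L)`. Up to the positive factor
`[P rainbow] · K · n^{K - #P}` this is the local law `μ_S(P)` of the rainbow pseudo-distribution (`A` = the vertices of
`S ∖ P` whose colour is not used by `P`, `x = K + 1 - #P`). -/
def rbSum (h : α → κ) (n : ℝ) (A : Finset α) (x : ℝ) : ℝ :=
  ∑ L ∈ A.powerset, if Set.InjOn h (↑L : Set α) then (-1 : ℝ) ^ L.card * (n⁻¹) ^ L.card / (x - L.card) else 0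

omit [DecidableEq α] in
/-- `R_∅(x) = 1/x`. -/
theorem rbSum_empty (h : α → κ) (n x : ℝ) : rbSum h n ∅ x = 1 / x := by
  classical
  simp [rbSum]

open Classical in
/-- The recursion `R_{A+v}(x) = R_A(x) - R_{A ∖ cl(v)}(x-1)/n` (`v ∉ A`; `cl(v)` = the colour class of `v`): a rainbow
subset of `A + v` either avoids `v`, or is `v` plus a rainbow subset of `A` avoiding the colour of `v`. -/
theorem rbSum_insert (h : α → κ) (n : ℝ) {A : Finset α} {v : α} (hv : v ∉ A) (x : ℝ) :
    rbSum h n (insert v A) x = rbSum h n A x - n⁻¹ * rbSum h n (A.filter fun a => h a ≠ h v) (x - 1) := by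
  unfold rbSum
  rw [Finset.sum_powerset_insert hv, sub_eq_add_neg]
  congr 1
  -- the subsets through `v`
  have hpow : (A.filter fun a => h a ≠ h v).powerset = A.powerset.filter (fun L => ∀ a ∈ L, h a ≠ h v) := by
    ext L
    simp only [mem_powerset, mem_filter, subset_iff]
    constructor
    · intro hL
      exact ⟨fun a ha => (hL ha).1, fun a ha => (hL ha).2⟩
    · rintro ⟨hL, hcol⟩ a ha
      exact ⟨hL ha, hcol a ha⟩
  rw [hpow, Finset.sum_filter, Finset.mul_sum, ← Finset.sum_neg_distrib]
  refine Finset.sum_congr rfl fun L hL => ?_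
  have hvL : v ∉ L := fun hvL => hv (mem_powerset.1 hL hvL)
  rw [card_insert_of_notMem hvL]
  by_cases hr : Set.InjOn h (↑L : Set α)
  · by_cases hcol : ∀ a ∈ L, h a ≠ h v
    · rw [if_pos ((rb_injOn_insert hvL).2 ⟨hr, hcol⟩), if_pos hcol, if_pos hr]
      push_cast
      rw [pow_succ, pow_succ]
      ring
    · rw [if_neg (fun hins => hcol ((rb_injOn_insert hvL).1 hins).2), if_neg hcol]
      simp
  · have : ¬ Set.InjOn h (↑(insert v L) : Set α) := fun hins => hr ((rb_injOn_insert hvL).1 hins).1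
    rw [if_neg this]
    by_cases hcol : ∀ a ∈ L, h a ≠ h v
    · rw [if_pos hcol, if_neg hr]
      simp
    · rw [if_neg hcol]
      simp

/-- **Two-sided bound for rainbow alternating sums.** For `0 < n`, `#A + 2 ≤ x` and `2 #A ≤ n`:
`1/x - #A/(n(x-1)) ≤ R_A(x) ≤ 1/x`. Proof: strong induction on `#A` through the recursion `rbSum_insert`
(the subtracted term is `R_B(x-1)/n` with `B ⊆ A - v`, which lies in `[0, 1/(x-1)]` by induction). [new packaging] -/
theorem rbSum_bounds (h : α → κ) {n : ℝ} (hn : 0 < n) :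
    ∀ (s : ℕ) (A : Finset α), A.card ≤ s → ∀ x : ℝ, (A.card : ℝ) + 2 ≤ x → 2 * (A.card : ℝ) ≤ n →
      1 / x - A.card / (n * (x - 1)) ≤ rbSum h n A x ∧ rbSum h n A x ≤ 1 / x := by
  classical
  intro s
  induction s with
  | zero =>
    intro A hA x hx _
    rw [Finset.card_eq_zero.1 (Nat.le_zero.1 hA), rbSum_empty]
    simp
  | succ s ih =>
    intro A hA x hx hAn
    rcases A.eq_empty_or_nonempty with rfl | ⟨v, hv⟩
    · rw [rbSum_empty]; simp
    · -- `A = insert v A'`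
      set A' := A.erase v with hA'
      have hvA' : v ∉ A' := Finset.notMem_erase v A
      have hAeq : A = insert v A' := (Finset.insert_erase hv).symm
      have hcardA : A.card = A'.card + 1 := by rw [hAeq, card_insert_of_notMem hvA']
      have hcardA_real : (A.card : ℝ) = A'.card + 1 := by rw [hcardA]; push_cast; ring
      set B := A'.filter (fun a => h a ≠ h v) with hB
      have hBA' : B.card ≤ A'.card := card_filter_le _ _
      have hA's : A'.card ≤ s := by omega
      have hBs : B.card ≤ s := hBA'.trans hA's
      have hBreal : (B.card : ℝ) ≤ A'.card := by exact_mod_cast hBA'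
      -- induction hypotheses
      have ihA := ih A' hA's x (by linarith [hcardA_real, hx]) (by linarith [hcardA_real, hAn])
      have ihB := ih B hBs (x - 1) (by linarith [hcardA_real, hx, hBreal]) (by linarith [hcardA_real, hAn, hBreal])
      have hA'0 : (0 : ℝ) ≤ A'.card := Nat.cast_nonneg _
      have hx1 : 0 < x - 1 := by linarith [hcardA_real, hx]
      have hx2 : 0 < x - 2 := by linarith [hcardA_real, hx]
      -- `0 ≤ R_B(x-1)`
      have hBnn : 0 ≤ rbSum h n B (x - 1) := by
        refine le_trans ?_ ihB.1
        rw [sub_sub, show (1 : ℝ) + 1 = 2 by norm_num, sub_nonneg, div_le_div_iff₀ (by positivity) hx1, one_mul]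
        -- `#B (x-1) ≤ n (x-2)`
        have h1 : (B.card : ℝ) + 3 ≤ x := by linarith [hcardA_real, hx, hBreal]
        have h2 : 2 * (B.card : ℝ) + 2 ≤ n := by linarith [hcardA_real, hAn, hBreal]
        have hB0 : (0 : ℝ) ≤ B.card := Nat.cast_nonneg _
        nlinarith
      rw [hAeq, rbSum_insert h n hvA' x, ← hB]
      constructor
      · -- lower bound
        have hup : rbSum h n B (x - 1) ≤ 1 / (x - 1) := ihB.2
        have hcardins : ((insert v A').card : ℝ) = A'.card + 1 := by
          rw [card_insert_of_notMem hvA']; push_cast; ring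
        rw [hcardins]
        have : n⁻¹ * rbSum h n B (x - 1) ≤ 1 / (n * (x - 1)) := by
          rw [one_div, mul_inv, ← one_div (x - 1)]
          exact mul_le_mul_of_nonneg_left hup (by positivity)
        have hsplit : 1 / x - ((A'.card : ℝ) + 1) / (n * (x - 1)) = (1 / x - A'.card / (n * (x - 1))) - 1 / (n * (x - 1)) := by
          ring
        rw [hsplit]
        linarith [ihA.1]
      · -- upper bound
        have : 0 ≤ n⁻¹ * rbSum h n B (x - 1) := mul_nonneg (by positivity) hBnn
        linarith [ihA.2]

/-- **Rainbow alternating sums are non-negative** when `#A + 2 ≤ x`, `2 #A ≤ n` (`0 < n`). -/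
theorem rbSum_nonneg (h : α → κ) {n : ℝ} (hn : 0 < n) (A : Finset α) (x : ℝ) (hx : (A.card : ℝ) + 2 ≤ x)
    (hAn : 2 * (A.card : ℝ) ≤ n) : 0 ≤ rbSum h n A x := by
  refine le_trans ?_ (rbSum_bounds h hn A.card A le_rfl x hx hAn).1
  have hA0 : (0 : ℝ) ≤ A.card := Nat.cast_nonneg _
  have hx0 : 0 < x := by linarith
  have hx1 : 0 < x - 1 := by linarith
  rw [sub_nonneg, div_le_div_iff₀ (by positivity) hx0, one_mul]
  nlinarith

end rainbow

/-- **Registered helper stub (local laws of the rainbow pseudo-distribution are non-negative).** Restatement of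
`rbSum_nonneg` with all parameters explicit: for a colouring `h`, `0 < n`, `#A + 2 ≤ x` and `2 #A ≤ n`, the rainbow
alternating sum `R_A(x) = ∑_{L ⊆ A rainbow} (-1)^{#L} n^{-#L}/(x - #L)` is `≥ 0`. -/
theorem rainbow_sum_nonneg : ∀ {α κ : Type} [DecidableEq α] [DecidableEq κ] (h : α → κ) {n : ℝ}, 0 < n → ∀ (A : Finset α) (x : ℝ), (A.card : ℝ) + 2 ≤ x → 2 * (A.card : ℝ) ≤ n → 0 ≤ rbSum h n A x := by
  intro α κ _ _ h n hn A x hx hAn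
  exact rbSum_nonneg h hn A x hx hAn

end

end Summit.PneNP.PneNP.Theorems
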